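import Summits.Ventures.PercRepro.S1FlatBudget
import Summits.Ventures.PercRepro.S1JointYSide

/-!
# PercRepro — S1 LEMMA E, TWO BIG FLATS CARRY ALL THE NULLITY (p2, gen 16; SUBCLAIM-S1 §4 (A14))

A set `X ⊆ E` with `|X| = r(X) + d` (the full nullity `d = |E| − r(E)`) contains every circuit: an element
`e ∉ X` would have `r(E ∖ {e}) ≤ r(X) + |E ∖ X| − 1 = r(E) − 1`, but a circuit through `e` puts `e` in
`cl(E ∖ {e})`, so `r(E ∖ {e}) = r(E)`. Two distinct rank-`4` flats with `|F| + |F'| = d + 11` — the extreme case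
of LEMMA A — meet in a six-point plane and their union has `d + 5` points and the full nullity `d`; hence the union
`S₀` of the circuits with `≤ 5` elements lies in `F ∪ F'` and has at most `d + 5` points.

* **`circuit_subset_of_ncard_eq`** — a full-nullity set contains every circuit;
* **`ncard_union_eq_of_flats_add_eq`** — `|F| + |F'| = d + 11 ⇒ |F ∪ F'| = r(F ∪ F') + d ∧ |F ∪ F'| = d + 5`;
* **`sUnion_circuitsLE_subset_of_flats_add_eq`** / **`ncard_sUnion_circuitsLE_le_of_flats_add_eq`** — `S₀ ⊆ F ∪ F'`,
  `|S₀| ≤ d + 5`.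
Axioms: standard.
-/

open scoped Matroid

namespace PercRepro

namespace S1

open Set

variable {α : Type}

/-- **A full-nullity set contains every circuit**: if `|E| = r(E) + d` and `X ⊆ E` has `|X| = r(X) + d`, then
every circuit `C` satisfies `C ⊆ X`. -/
theorem circuit_subset_of_ncard_eq (M : Matroid α) [M.Finite] {X : Set α} (hX : X ⊆ M.E) {d rX : ℕ}
    (hd : M.E.encard = M.eRank + d) (hrX : M.eRk X = (rX : ℕ∞)) (hXd : X.ncard = rX + d)
    {C : Set α} (hC : M.IsCircuit C) : C ⊆ X := by
  by_contra hnot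
  obtain ⟨e, heC, heX⟩ := Set.not_subset.1 hnot
  have heE : e ∈ M.E := hC.subset_ground heC
  have hXfin : X.Finite := M.ground_finite.subset hX
  -- the rank of `E` as a natural
  have hEne : M.eRank ≠ ⊤ := ne_top_of_le_ne_top M.ground_finite.encard_lt_top.ne M.eRank_le_encard_ground
  obtain ⟨rE, hrE⟩ := ENat.ne_top_iff_exists.1 hEne
  have hEcard : M.E.ncard = rE + d := by
    have h := hd
    rw [← hrE, ← M.ground_finite.cast_ncard_eq] at h
    exact_mod_cast h
  -- `E ∖ {e} = X ∪ ((E ∖ X) ∖ {e})`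
  have hdecomp : M.E \ {e} = X ∪ ((M.E \ X) \ {e}) := by
    ext x
    simp only [mem_sdiff, mem_union, mem_singleton_iff]
    constructor
    · rintro ⟨hxE, hxe⟩
      by_cases hx : x ∈ X
      · exact Or.inl hx
      · exact Or.inr ⟨⟨hxE, hx⟩, hxe⟩
    · rintro (hx | ⟨⟨hxE, -⟩, hxe⟩)
      · exact ⟨hX hx, fun h => heX (h ▸ hx)⟩
      · exact ⟨hxE, hxe⟩
  -- `|(E ∖ X) ∖ {e}| = rE − rX − 1`
  have hcompl : (M.E \ X).ncard = rE - rX := by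
    rw [Set.ncard_sdiff' hX M.ground_finite, hEcard, hXd]; omega
  have heEX : e ∈ M.E \ X := ⟨heE, heX⟩
  have hcompl' : ((M.E \ X) \ {e}).ncard = rE - rX - 1 := by
    rw [Set.ncard_sdiff_singleton_of_mem heEX, hcompl]
  have hpos : 1 ≤ rE - rX := by
    have : 0 < (M.E \ X).ncard := (Set.ncard_pos (M.ground_finite.subset sdiff_subset)).2 ⟨e, heEX⟩
    omega
  -- `r(E ∖ {e}) ≤ rE − 1`
  have hle : M.eRk (M.E \ {e}) ≤ ((rE - 1 : ℕ) : ℕ∞) := by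
    rw [hdecomp]
    calc M.eRk (X ∪ ((M.E \ X) \ {e})) ≤ M.eRk X + ((M.E \ X) \ {e}).encard :=
          M.eRk_union_le_eRk_add_encard _ _
      _ = ((rX + (rE - rX - 1) : ℕ) : ℕ∞) := by
          rw [hrX, ← (M.ground_finite.subset (sdiff_subset.trans sdiff_subset)).cast_ncard_eq, hcompl']
          push_cast; rfl
      _ = ((rE - 1 : ℕ) : ℕ∞) := by congr 1; omega
  -- but `e ∈ cl(C ∖ {e}) ⊆ cl(E ∖ {e})`, so `E ⊆ cl(E ∖ {e})` and `r(E ∖ {e}) = r(E)`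
  have hecl : e ∈ M.closure (M.E \ {e}) := by
    have h1 := hC.mem_closure_sdiff_singleton_of_mem heC
    exact M.closure_subset_closure (Set.sdiff_subset_sdiff_left hC.subset_ground) h1
  have hEsub : M.E ⊆ M.closure (M.E \ {e}) := by
    intro x hx
    by_cases hxe : x = e
    · rw [hxe]; exact hecl
    · exact M.subset_closure (M.E \ {e}) sdiff_subset ⟨hx, hxe⟩
  have hge : M.eRank ≤ M.eRk (M.E \ {e}) := by
    calc M.eRank = M.eRk M.E := M.eRank_def
      _ ≤ M.eRk (M.closure (M.E \ {e})) := M.eRk_mono hEsub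
      _ = M.eRk (M.E \ {e}) := M.eRk_closure_eq _
  have : (rE : ℕ∞) ≤ ((rE - 1 : ℕ) : ℕ∞) := by rw [hrE]; exact hge.trans hle
  have h' : rE ≤ rE - 1 := by exact_mod_cast this
  omega

/-- **THE EXTREME CASE OF LEMMA A**: two distinct rank-`4` flats with `|F| + |F'| = d + 11` meet in a set of rank
`3`, and their union has `d + 5` points and the full nullity: `|F ∪ F'| = r(F ∪ F') + d`. -/
theorem ncard_union_eq_of_flats_add_eq (M : Matroid α) [M.Finite]
    (hcirc : ∀ C, M.IsCircuit C → 3 ≤ C.encard)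
    (hline : ∀ L ⊆ M.E, M.eRk L ≤ 2 → L.ncard ≤ 3) (hplane : ∀ P ⊆ M.E, M.eRk P ≤ 3 → P.ncard ≤ 6)
    {d : ℕ} (hd : M.E.encard = M.eRank + d) {F F' : Set α} (hF : F ⊆ M.E) (hclF : M.closure F = F)
    (hrF : M.eRk F = 4) (hF' : F' ⊆ M.E) (hclF' : M.closure F' = F') (hrF' : M.eRk F' = 4)
    (hne : F ≠ F') (hsum : F.ncard + F'.ncard = d + 11) :
    ∃ rU : ℕ, M.eRk (F ∪ F') = (rU : ℕ∞) ∧ (F ∪ F').ncard = rU + d ∧ (F ∪ F').ncard = d + 5 := by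
  have hFfin : F.Finite := M.ground_finite.subset hF
  have hF'fin : F'.Finite := M.ground_finite.subset hF'
  have hXE : F ∩ F' ⊆ M.E := inter_subset_left.trans hF
  have hUE : F ∪ F' ⊆ M.E := union_subset hF hF'
  have hXne : M.eRk (F ∩ F') ≠ ⊤ :=
    ne_top_of_le_ne_top (hFfin.subset inter_subset_left).encard_lt_top.ne (M.eRk_le_encard _)
  obtain ⟨rX, hrX⟩ := ENat.ne_top_iff_exists.1 hXne
  have hUne : M.eRk (F ∪ F') ≠ ⊤ :=
    ne_top_of_le_ne_top (hFfin.union hF'fin).encard_lt_top.ne (M.eRk_le_encard _)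
  obtain ⟨rU, hrU⟩ := ENat.ne_top_iff_exists.1 hUne
  have hX3 : rX ≤ 3 := by
    have := eRk_inter_le_three_of_flats_ne M hF hclF hrF hclF' hrF' hne
    rw [← hrX] at this
    exact_mod_cast this
  have hsub : rX + rU ≤ 8 := by
    have := M.eRk_inter_add_eRk_union_le F F'
    rw [← hrX, ← hrU, hrF, hrF'] at this
    exact_mod_cast this
  have hXcard : (F ∩ F').ncard ≤ rX + 3 :=
    ncard_le_eRk_add_three_of_eRk_le_three M hline hplane hXE hrX.symm hX3
  have hUcard : (F ∪ F').ncard ≤ rU + d := ncard_le_add_of_nullity M hUE hd hrU.symm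
  have hmod := Set.ncard_union_add_ncard_inter F F' hFfin hF'fin
  -- equality throughout: `|F ∩ F'| = rX + 3`, `rX + rU = 8`, `|F ∪ F'| = rU + d`
  have hXeq : (F ∩ F').ncard = rX + 3 := by omega
  have hUeq : (F ∪ F').ncard = rU + d := by omega
  have h8 : rX + rU = 8 := by omega
  -- `rX = 3`: a set of rank `≤ 2` with `rX + 3 ≥ 3` points forces `rX = 0` and three points of rank `0`
  have hrX3 : rX = 3 := by
    by_contra hne3
    have hX2 : M.eRk (F ∩ F') ≤ 2 := by
      rw [← hrX]; exact_mod_cast (show rX ≤ 2 by omega)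
    have h3 : (F ∩ F').ncard ≤ 3 := hline _ hXE hX2
    have hrX0 : rX = 0 := by omega
    -- two distinct points of `F ∩ F'` have rank `2`
    have h2 : 1 < (F ∩ F').ncard := by omega
    obtain ⟨a, ha, b, hb, hab⟩ := (Set.one_lt_ncard (M.ground_finite.subset hXE)).1 h2
    have hpair : M.eRk {a, b} = 2 := eRk_pair_eq_two_of_hcirc M hcirc (hXE ha) (hXE hb) hab
    have : M.eRk {a, b} ≤ M.eRk (F ∩ F') := M.eRk_mono (pair_subset ha hb)
    rw [hpair, ← hrX, hrX0] at this
    exact absurd this (by norm_num)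
  refine ⟨rU, hrU.symm, hUeq, ?_⟩
  omega

/-- **`S₀ ⊆ F ∪ F'`** for two distinct rank-`4` flats with `|F| + |F'| = d + 11`: every circuit lies in the union. -/
theorem sUnion_circuitsLE_subset_of_flats_add_eq (M : Matroid α) [M.Finite]
    (hcirc : ∀ C, M.IsCircuit C → 3 ≤ C.encard)
    (hline : ∀ L ⊆ M.E, M.eRk L ≤ 2 → L.ncard ≤ 3) (hplane : ∀ P ⊆ M.E, M.eRk P ≤ 3 → P.ncard ≤ 6)
    {d : ℕ} (hd : M.E.encard = M.eRank + d) {F F' : Set α} (hF : F ⊆ M.E) (hclF : M.closure F = F)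
    (hrF : M.eRk F = 4) (hF' : F' ⊆ M.E) (hclF' : M.closure F' = F') (hrF' : M.eRk F' = 4)
    (hne : F ≠ F') (hsum : F.ncard + F'.ncard = d + 11) (k : ℕ) :
    ⋃₀ Matroid.circuitsLE M k ⊆ F ∪ F' := by
  obtain ⟨rU, hrU, hUeq, -⟩ :=
    ncard_union_eq_of_flats_add_eq M hcirc hline hplane hd hF hclF hrF hF' hclF' hrF' hne hsum
  intro x hx
  obtain ⟨C, hC, hxC⟩ := mem_sUnion.1 hx
  exact circuit_subset_of_ncard_eq M (union_subset hF hF') hd hrU hUeq hC.1 hxC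

/-- **`|S₀| ≤ d + 5`** for two distinct rank-`4` flats with `|F| + |F'| = d + 11`. -/
theorem ncard_sUnion_circuitsLE_le_of_flats_add_eq (M : Matroid α) [M.Finite]
    (hcirc : ∀ C, M.IsCircuit C → 3 ≤ C.encard)
    (hline : ∀ L ⊆ M.E, M.eRk L ≤ 2 → L.ncard ≤ 3) (hplane : ∀ P ⊆ M.E, M.eRk P ≤ 3 → P.ncard ≤ 6)
    {d : ℕ} (hd : M.E.encard = M.eRank + d) {F F' : Set α} (hF : F ⊆ M.E) (hclF : M.closure F = F)
    (hrF : M.eRk F = 4) (hF' : F' ⊆ M.E) (hclF' : M.closure F' = F') (hrF' : M.eRk F' = 4)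
    (hne : F ≠ F') (hsum : F.ncard + F'.ncard = d + 11) (k : ℕ) :
    (⋃₀ Matroid.circuitsLE M k).ncard ≤ d + 5 := by
  obtain ⟨-, -, -, h5⟩ :=
    ncard_union_eq_of_flats_add_eq M hcirc hline hplane hd hF hclF hrF hF' hclF' hrF' hne hsum
  have hsub := sUnion_circuitsLE_subset_of_flats_add_eq M hcirc hline hplane hd hF hclF hrF hF' hclF' hrF' hne hsum k
  have hfin : (F ∪ F').Finite := M.ground_finite.subset (union_subset hF hF')
  exact (Set.ncard_le_ncard hsub hfin).trans h5.le

end S1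

end PercRepro
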